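/-
Copyright (c) 2026 the pub-hodgecm-mathlib formalisation cell (harness21).  Prover seat hodgecm-mathlib-K2E1-p15 (g3), Track B ∕ K2-LIT, h413 = `stmt-HodgeConjecture-24833`,
R90-TF section S8 «ContSpec-n½» (planner R90-CS-plan (g0), deal (A) 2026-09-04T16:23:19Z, this seat's census v1 16:24:37Z, LAYER 1): the generic Hilbert-space ENGINE of the #4 assembly
`R90S8ResHLeClosureCharLinesOfLetters` — «inside the closed span of blocks `atoms ⊕ lines`, a vector with no line mass lies in the closed span of the atoms».
-/
import Mathlib.Analysis.InnerProductSpace.Projection.Submodule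
import Mathlib.Analysis.InnerProductSpace.Orthogonal
import HarnessLib

/-!
# S8 #4 road, LAYER 1 — `R90S8LeClosureOfBlockLetters`: closure twin of ★ `R90S8OrthoLeft` and the ABSTRACT ASSEMBLY «density + exhaustion by blocks `At ⊕ Ln` + no line mass + atoms in `C`
# ⟹ `P ≤ closure C`» that fixes the letter shapes of the `U(Φ₂)` residual-spectrum socket `sock_S8_resH_spannedByCharLines`

Track B ∕ K2-LIT, crux h413 = `stmt-HodgeConjecture-24833`, route of record `HCCMUnconditional`; cell `hodgecm-mathlib`, R90-TF programme, section S8 «ContSpec-n½», socket #4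
(«`L²_res(U(Φ₂)) ≤ closure ⨆_ψ ℂ·(ψ∘det)`», ruling S8-R8).  PURE MATHLIB (inner-product spaces); THEOREMS ONLY (no `def`, no `instance`, no `notation`, no named-fact hypothesis, no
`sorry`; default heartbeats); lane `--supports stmt-HodgeConjecture-24833 --as helper` (count-neutral).  Closes no socket: LAYER 2 (`R90S8ResHLeClosureCharLinesOfLetters`) instantiates the
letters below at `cmDatum L 2 Φ₂` with ★ HEAD″ p861008 (exhaustion), ★ R6 p861668∕p861714 + ★ p860865 (orthogonality ∕ block splitting), ★ D5′ p860349 (no line mass), a density lemma,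
and the ONE letter (L-SD) «SD residue atoms lie in `⨆_ψ charLine₂ ψ`» (K2E2-p12's file (B)).

THE MATHEMATICS ([ReedSimonI1980, Thm. II.3 (projection theorem)]; [MoeglinWaldspurger1995, II.2.4, V.3.13 for the use]).  Let `E` be a complex Hilbert space.
(G1) If `A ⟂ B`, `x ∈ closure (A + B)` and `x ⟂ B`, then `x ∈ closure A`: with `P` the orthogonal projection onto `B̄ := closure B` (complete), the continuous map `y ↦ y − P y` sends
`a + b ↦ a` (`P a = 0` as `A ⟂ B̄`, `P b = b`), hence `closure (A + B)` into `closure A`; and `P x = 0` because `x ⟂ B̄` (`B̄ᗮ = Bᗮ`, Mathlib `Submodule.orthogonal_closure`), so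
`x = x − P x ∈ closure A`.  (G2) Family form: `x ∈ closure ⨆_b (At_b + Ln_b)`, `(⨆ At) ⟂ (⨆ Ln)`, `x ⟂ Ln_b` for all `b` ⟹ `x ∈ closure ⨆_b At_b`.  (ASSEMBLY) For submodules `P`, `Q_i`
(`i` = level∕`K`-type), blocks `At_{i,b}, Ln_{i,b}` and a target `C`: DENSITY `P ≤ closure ⨆_i Q_i`, EXHAUSTION `Q_i ≤ closure ⨆_b (At_{i,b} + Ln_{i,b})`, ORTHOGONALITY `(⨆_b At_{i,b}) ⟂
(⨆_b Ln_{i,b})`, NO LINE MASS `Q_i ⟂ Ln_{i,b}`, ATOMS `At_{i,b} ≤ C` ⟹ `P ≤ closure C`.  At `U(Φ₂)`: `P` = an irreducible of `L²_res`, `Q_i = P ∩ L²^{(K′,ω)}`, the blocks are the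
`χ`-pseudo-Eisenstein wave packets split by the self-dual model isometry into residue ATOMS and the unitary-axis LINES (off-dual blocks: no atoms), `C = ⨆_ψ ℂ·(ψ∘det)`.
* §1 **`mem_topologicalClosure_left_of_isOrtho_right`** (G1), `mem_topologicalClosure_iSup_left_of_forall_mem_orthogonal` (G2).
* §2 **`le_topologicalClosure_of_block_letters`** — THE ABSTRACT ASSEMBLY (letters (D)(E)(O)(N)(L)).
HONEST LABEL: HC_CM is proved only modulo the 7 printed citations (2 remaining named inputs: hLiu418 = `stmt-HodgeConjecture-24832`, h413 = `stmt-HodgeConjecture-24833`) until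
rung 0 closes; REL ≠ ★ ≠ BUILT; this file asserts no named fact and closes no socket; count-neutral.

## References
* [ReedSimonI1980] M. Reed, B. Simon, *Methods of Modern Mathematical Physics I: Functional Analysis* (1980), Thm. II.3.
* [MoeglinWaldspurger1995] C. Mœglin, J.-L. Waldspurger, *Spectral Decomposition and Eisenstein Series* (1995), II.2.4, V.3.13.
-/

set_option autoImplicit false
set_option linter.dupNamespace false  -- the mandated namespace `…HodgeConjecture.HodgeConjecture.R90.S8` (LEAD #1 L1) repeats the summit's segment

noncomputable section

open scoped InnerProductSpace

namespace Summit.HodgeConjecture.HodgeConjecture.R90.S8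

variable {E : Type*} [NormedAddCommGroup E] [InnerProductSpace ℂ E] [CompleteSpace E]

/-! ## §1 Closure twin of `le_left_of_isOrtho_right`: no line mass inside `closure (A ⊔ B)` -/

/-- **(G1) — inside `closure (A ⊔ B)` with `A ⟂ B`, a vector orthogonal to `B` lies in `closure A`.**  With `P` the orthogonal projection onto the complete `B̄ = closure B`: `y ↦ y − P y` is
continuous and maps `A ⊔ B` into `A` (`P a = 0` since `A ⟂ B ⊆ B̄` i.e. `a ∈ B̄ᗮ = Bᗮ`, `P b = b`), hence `closure (A ⊔ B)` into `closure A`; `P x = 0` as `x ∈ Bᗮ = B̄ᗮ`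
(Mathlib `Submodule.orthogonal_closure`, `starProjection_apply_eq_zero_iff`, `starProjection_eq_self_iff`). [cite: ReedSimonI1980, Thm. II.3] -/
theorem mem_topologicalClosure_left_of_isOrtho_right {A B : Submodule ℂ E} (hAB : A ⟂ B) {x : E}
    (hx : x ∈ (A ⊔ B).topologicalClosure) (hxB : x ∈ Bᗮ) : x ∈ A.topologicalClosure := by
  -- the closure of `B`, complete, and its orthogonal projection
  set Bc : Submodule ℂ E := B.topologicalClosure with hBc
  haveI : CompleteSpace Bc := (Submodule.isClosed_topologicalClosure B).completeSpace_coe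
  set f : E →L[ℂ] E := ContinuousLinearMap.id ℂ E - Bc.starProjection with hf
  -- `f` maps `A ⊔ B` into `closure A`
  have hmaps : A ⊔ B ≤ (A.topologicalClosure).comap (f : E →ₗ[ℂ] E) := by
    intro y hy
    obtain ⟨a, ha, b, hb, rfl⟩ := Submodule.mem_sup.mp hy
    have hPa : Bc.starProjection a = 0 := by
      rw [Submodule.starProjection_apply_eq_zero_iff, hBc, Submodule.orthogonal_closure]
      exact hAB.le ha
    have hPb : Bc.starProjection b = b := Submodule.starProjection_eq_self_iff.mpr (Submodule.le_topologicalClosure B hb)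
    change f (a + b) ∈ A.topologicalClosure
    rw [hf, sub_apply, ContinuousLinearMap.id_apply, map_add, hPa, hPb, zero_add, add_sub_cancel_right]
    exact Submodule.le_topologicalClosure A ha
  -- … hence `closure (A ⊔ B)` too (the preimage of a closed set under the continuous `f` is closed)
  have hcl : (A ⊔ B).topologicalClosure ≤ (A.topologicalClosure).comap (f : E →ₗ[ℂ] E) :=
    Submodule.topologicalClosure_minimal _ hmaps ((Submodule.isClosed_topologicalClosure A).preimage f.continuous)
  have hfx : f x ∈ A.topologicalClosure := hcl hx
  -- and `P x = 0`
  have hPx : Bc.starProjection x = 0 := by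
    rw [Submodule.starProjection_apply_eq_zero_iff, hBc, Submodule.orthogonal_closure]
    exact hxB
  rw [hf, sub_apply, ContinuousLinearMap.id_apply, hPx, sub_zero] at hfx
  exact hfx

/-- **(G2) — family form**: if `x ∈ closure ⨆_b (At_b ⊔ Ln_b)`, the atom span is orthogonal to the line span (`(⨆ At) ⟂ (⨆ Ln)`) and `x` has NO LINE MASS (`x ⟂ Ln_b` for every `b`), then
`x ∈ closure ⨆_b At_b` ((G1) with `A := ⨆ At`, `B := ⨆ Ln`, Mathlib `iSup_sup_eq`, `Submodule.isOrtho_iSup_right`). [cite: ReedSimonI1980, Thm. II.3] -/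
theorem mem_topologicalClosure_iSup_left_of_forall_mem_orthogonal {β : Type*} (At Ln : β → Submodule ℂ E)
    (hO : (⨆ b, At b) ⟂ (⨆ b, Ln b)) {x : E} (hx : x ∈ (⨆ b, (At b ⊔ Ln b)).topologicalClosure) (hN : ∀ b, x ∈ (Ln b)ᗮ) :
    x ∈ (⨆ b, At b).topologicalClosure := by
  rw [iSup_sup_eq] at hx
  refine mem_topologicalClosure_left_of_isOrtho_right hO hx ?_
  rw [← Submodule.iInf_orthogonal]
  exact (Submodule.mem_iInf _).mpr hN

/-! ## §2 The abstract assembly of the #4 road -/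

/-- **THE ABSTRACT ASSEMBLY — `P ≤ closure C` from the five letters.**  For submodules `P` (the irreducible), `Q i` (its level∕`K`-type pieces), blocks `At i b` (atoms) and `Ln i b`
(lines) and a target `C` of a complex Hilbert space: (D) DENSITY `P ≤ closure ⨆_i Q_i`; (E) EXHAUSTION `Q_i ≤ closure ⨆_b (At_{i,b} ⊔ Ln_{i,b})`; (O) ORTHOGONALITY `(⨆_b At_{i,b}) ⟂ (⨆_b Ln_{i,b})`;
(N) NO LINE MASS `Q_i ≤ (Ln_{i,b})ᗮ`; (L) ATOMS `At_{i,b} ≤ C` ⟹ `P ≤ closure C`.  (E)+(O)+(N) give `Q_i ≤ closure ⨆_b At_{i,b}` ((G2)), (L) gives `≤ closure C`, and (D) +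
`closure`-minimality conclude.  LAYER 2 instantiates: `P` = an irreducible closed subrepresentation of `L²_res(U(Φ₂))`, `Q_{(K′,ω)} = P ∩ L²^{(K′,ω)}`, blocks = the `χ`-pseudo-Eisenstein
packets split by the self-dual model isometry, `C = ⨆_ψ ℂ·(ψ∘det)` (letter (L) = (L-SD)). [cite: MoeglinWaldspurger1995, II.2.4, V.3.13] [cite: ReedSimonI1980, Thm. II.3] -/
theorem le_topologicalClosure_of_block_letters {ι : Type*} {β : ι → Type*}
    (P : Submodule ℂ E) (Q : ι → Submodule ℂ E) (At Ln : ∀ i, β i → Submodule ℂ E) (C : Submodule ℂ E)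
    (hD : P ≤ (⨆ i, Q i).topologicalClosure)
    (hE : ∀ i, Q i ≤ (⨆ b, (At i b ⊔ Ln i b)).topologicalClosure)
    (hO : ∀ i, (⨆ b, At i b) ⟂ (⨆ b, Ln i b))
    (hN : ∀ i b, Q i ≤ (Ln i b)ᗮ)
    (hL : ∀ i b, At i b ≤ C) :
    P ≤ C.topologicalClosure := by
  -- each piece `Q i` lies in `closure C`
  have hQ : ∀ i, Q i ≤ C.topologicalClosure := by
    intro i x hx
    have h1 : x ∈ (⨆ b, At i b).topologicalClosure :=
      mem_topologicalClosure_iSup_left_of_forall_mem_orthogonal (At i) (Ln i) (hO i) (hE i hx) fun b => hN i b hx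
    exact Submodule.topologicalClosure_mono (iSup_le fun b => hL i b) h1
  -- hence so does the closure of their span, and `P`
  exact hD.trans (Submodule.topologicalClosure_minimal _ (iSup_le hQ) (Submodule.isClosed_topologicalClosure C))

end Summit.HodgeConjecture.HodgeConjecture.R90.S8

end
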